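import Mathlib
import Summits.NavierStokesRegularity.NavierStokesRegularity.Theorems.TaoLadderRungTwoFlatTruncatedDeviation
import Summits.NavierStokesRegularity.NavierStokesRegularity.Theorems.TaoLadderRungTwoFlatNonlinearHopForced
import Summits.NavierStokesRegularity.NavierStokesRegularity.Theorems.TaoLadderRungTwoFlatGaugeCaptureDefs
import Summits.NavierStokesRegularity.NavierStokesRegularity.Theorems.TaoLadderRungTwoFlatPulseFlows
import HarnessLib

/-!
# The LOCALISED hop estimate behind a captured pulse (junk race L8b-3, assembled at λ₀ = 1)
  (helper for the λ₀ = 1 layer stmt-NavierStokesRegularity-23908 `MirrorSolitaryWave` and the transfer theorem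
  stmt-…-23909, children of K_A♭ stmt-…-22987; route TaoLadderRungTwoFlat; cell harvest/h2-tao-ladder, p1 g21;
  LADDER §49.5 (b))

`MirrorPulse.truncated_hop_estimate`: homogeneous mirror lattice `T♭(ε)`; `Φ` and `X` exact global solutions bounded
by `M`; `(S2)` in the exposed-gauge form `HopContractionWith ε τ Φ (geomGauge g b) ρ C N` (SPLIT-T48 child 1's
export); an edge shell `e`. Let `u = X − Φ` and `η = truncFam e u` (the deviation AHEAD of the edge, zero behind).
If `geomGauge·|η(0)| ≤ B`, `headGauge·|η(0)| ≤ B'` (CORE-ZONE norms — the junk behind the edge does not enter) and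
the interface forcing obeys `headGauge·|interfaceForcing ε 0 e Φ u| ≤ F` on `[0, Nτ]` (first order in the pulse
amplitude at the edge and the interface deviations, `…TruncatedDeviation`), then after the hop
`geomGauge_{i,k}·|η_{i,k+N}(Nτ) − c₁Φ̇_{i,k+N}(Nτ) − c₂Φ_{i,k+N}(Nτ)| ≤ ρB + (‖T♭‖₁g·R² + F)·Nτ·e^{L'Nτ}`,
`R = (B' + F·Nτ)e^{L'Nτ}`, `L' = 2‖T♭‖₁Mg`, for some `|c₁|, |c₂| ≤ CB`. This is p1 g20's `pulse_hop_geom` estimate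
with the quadratic remainder LOCALISED to the core zone plus the interface input — the core-zone half of theory-1's
two-zone loop (`…TwoZoneLoop`), the behind half being `…CoMovingEnergyDecay`.

HONEST FRAMING: a conditional estimate about a MODEL lattice (Tao 2016 §4 vocabulary on `S♭`); the pulse, (S2) and all
bounds are HYPOTHESES; nothing certified; nothing about the Navier–Stokes equations.
-/

noncomputable section

-- the sub-problem namespace repeats the summit name by design (D-0017)
set_option linter.dupNamespace false

namespace Summit.NavierStokesRegularity.NavierStokesRegularity.Theorems

open Set Filter Literature.Analysis.FluidPDE Literature.Analysis.FluidPDE.TaoCascade QuadPolar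
open scoped Topology

namespace MirrorPulse

/-- The core truncation of a continuous family is continuous at every site.
[cite: Tao2016AveragedNS, §4 (4.8); route TaoLadderRungTwoFlat, L8b-3] -/
theorem continuous_truncFam {e : ℤ} {u : Fin 2 → ℤ → ℝ → ℝ} (hu : ∀ i k, Continuous (u i k)) (i : Fin 2) (k : ℤ) :
    Continuous (truncFam e u i k) := by
  by_cases hk : e + 1 ≤ k
  · rw [truncFam_of_le hk]; exact hu i k
  · rw [truncFam_of_gt (by omega : k ≤ e)]; exact continuous_const

/-- `W + truncFam e u` is `W + u` ahead of the edge and `W` behind: it inherits any common sup bound.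
[cite: Tao2016AveragedNS, §4 (4.8); route TaoLadderRungTwoFlat, L8b-3] -/
theorem abs_add_truncFam_le {e : ℤ} {W u : Fin 2 → ℤ → ℝ → ℝ} {M : ℝ} (hW : ∀ i k t, |W i k t| ≤ M)
    (hX : ∀ i k t, |(W + u) i k t| ≤ M) (i : Fin 2) (k : ℤ) (t : ℝ) : |(W + truncFam e u) i k t| ≤ M := by
  by_cases hk : e + 1 ≤ k
  · have h : (W + truncFam e u) i k t = (W + u) i k t := by simp [Pi.add_apply, truncFam, hk]
    rw [h]; exact hX i k t
  · have h : (W + truncFam e u) i k t = W i k t := by simp [Pi.add_apply, truncFam, hk]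
    rw [h]; exact hW i k t

/-- **THE LOCALISED HOP ESTIMATE (L8b-3 at λ₀ = 1).** See the module docstring.
[cite: Tao2016AveragedNS, §4 (4.8) and §6.3–6.4 (statement shape); route TaoLadderRungTwoFlat, transfer lemma L8b-3 (LADDER §49.5 (b))] -/
theorem truncated_hop_estimate {ε τ : ℝ} {Φ X : Fin 2 → ℤ → ℝ → ℝ} {g b ρ C M B B' F : ℝ} {N : ℕ} {e : ℤ}
    (hΦ : IsGlobalSol ε Φ) (hX : IsGlobalSol ε X) (hτ : 0 ≤ τ)
    (hΦb : ∀ i n t, |Φ i n t| ≤ M) (hXb : ∀ i n t, |X i n t| ≤ M) (hg : 1 ≤ g) (hb : 1 ≤ b)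
    (hS2 : HopContractionWith ε τ Φ (geomGauge g b) ρ C N)
    (hB : ∀ i k, geomGauge g b i k * |truncFam e (X - Φ) i k 0| ≤ B)
    (hB' : ∀ i k, headGauge g i k * |truncFam e (X - Φ) i k 0| ≤ B') (hF : 0 ≤ F)
    (hfb : ∀ j k, ∀ t ∈ Icc 0 ((N : ℝ) * τ), headGauge g j k * |interfaceForcing ε 0 e Φ (X - Φ) j k t| ≤ F) :
    ∃ c₁ c₂ : ℝ, |c₁| ≤ C * B ∧ |c₂| ≤ C * B ∧
      ∀ (i : Fin 2) (k : ℤ), geomGauge g b i k *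
          |truncFam e (X - Φ) i (k + N) (N * τ)
            - c₁ * quadTermOn shiftSetFlat 0 (mirrorTable ε ε) Φ i (k + N) (N * τ)
            - c₂ * Φ i (k + N) (N * τ)| ≤
        ρ * B + 1 * ((tableAbsSum shiftSetFlat (mirrorTable ε ε) * g *
            ((B' + F * (N * τ)) * Real.exp (2 * tableAbsSum shiftSetFlat (mirrorTable ε ε) * M * g * (N * τ))) ^ 2
            + F) * (N * τ) * Real.exp (2 * tableAbsSum shiftSetFlat (mirrorTable ε ε) * M * g * (N * τ))) := by
  obtain ⟨hωpos, -, -, -, -, hbody⟩ := hS2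
  set u : Fin 2 → ℤ → ℝ → ℝ := X - Φ with hu
  have hΦu : Φ + u = X := by rw [hu]; abel
  have hT : 0 ≤ (N : ℝ) * τ := by positivity
  have hw : IsWindowRegular (headGauge g) g := isWindowRegular_headGauge hg
  have hA : IsWindowAdmissible (headGauge g) g := isWindowAdmissible_headGauge hg
  have hΓ : ∀ i k, geomGauge g b i k ≤ 1 * headGauge g i (k + (N : ℤ)) := fun i k =>
    geomGauge_le_headGauge_shift hg hb i k N
  have hΦc : ∀ i k, Continuous (Φ i k) := fun i k => hΦ.continuous i k
  have huc : ∀ i k, Continuous (u i k) := fun i k => by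
    have h : Continuous fun t => X i k t - Φ i k t := (hX.continuous i k).sub (hΦ.continuous i k)
    exact h
  have hηc : ∀ j k, Continuous (truncFam e u j k) := continuous_truncFam huc
  have hXb' : ∀ i k t, |(Φ + u) i k t| ≤ M := by rw [hΦu]; exact hXb
  have hXηb : ∀ i k t, |(Φ + truncFam e u) i k t| ≤ M := abs_add_truncFam_le hΦb hXb'
  have hfc : ∀ j k, Continuous (interfaceForcing ε 0 e Φ u j k) := continuous_interfaceForcing hΦc huc
  have hη : ∀ i n t, HasDerivAt (truncFam e u i n)
      (quadTermOn shiftSetFlat 0 (mirrorTable ε ε) (Φ + truncFam e u) i n t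
        - quadTermOn shiftSetFlat 0 (mirrorTable ε ε) Φ i n t + interfaceForcing ε 0 e Φ u i n t) t := by
    intro i n t
    refine hasDerivAt_truncFam (fun j k => hΦ j k t) (fun j k => ?_) i n
    rw [hΦu]; exact hX j k t
  have hlin : ∀ v : Fin 2 → ℤ → ℝ → ℝ,
      (∀ i n t, HasDerivAt (v i n) (linTermOn shiftSetFlat 0 (mirrorTable ε ε) Φ v i n t) t) →
      (∃ Mu : ℝ, ∀ i n, ∀ t ∈ Icc 0 ((N : ℝ) * τ), |v i n t| ≤ Mu) →
      (∀ i k, geomGauge g b i k * |v i k 0| ≤ B) →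
        ∃ c₁ c₂ : ℝ, |c₁| ≤ C * B ∧ |c₂| ≤ C * B ∧
          ∀ i k, geomGauge g b i k * |v i (k + (N : ℤ)) ((N : ℝ) * τ)
            - c₁ * quadTermOn shiftSetFlat 0 (mirrorTable ε ε) Φ i (k + (N : ℤ)) ((N : ℝ) * τ)
            - c₂ * Φ i (k + (N : ℤ)) ((N : ℝ) * τ)| ≤ ρ * B := by
    intro v hvd hvb hBv
    exact hbody v B ⟨hvd, hvb⟩ hBv
  exact nonlinear_hop_estimate_forced isNearestNeighbourSet_shiftSetFlat (mirrorTable ε ε) hw hA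
    (fun i k => (hωpos i k).le) (N := (N : ℤ)) hΓ hT hΦ hηc hΦb hXηb hfc hfb hF hη hlin hB hB'

end MirrorPulse

end Summit.NavierStokesRegularity.NavierStokesRegularity.Theorems

end
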